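import Literature.MathematicalPhysics.QuantumFieldTheory.Balaban1983to89.B9Eq3105FamThreeCore

/-!
# `Balaban1983to89.B9Cor36CollarSeparation` — THE COLLAR SEPARATION IN THE MEMBER's DISTANCE (2.46): blocks of `𝔅` meeting the window `NearC r₁` of a cover
# cube □ and blocks meeting the complement of a wider window `NearC r₂` (`r₂ ≤ 3S_j`) are at torus block-distance `d_T ≥ (r₂ + 1 − r₁)/L^{j+1} − 1 =
# M_h·(r₂ + 1 − r₁)/S_j − 1` — the one geometric input of the in-tree suppliers of the located `G′`-difference entries `hDL`∕`hDR` (memo D1, files F3-E2∕F3-E3)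
# and of the located `C`-difference word (memo D2, file F3-B3) of family 3 of (3.105) (sub-row G-B9-LETTERS, GAPS G-B9-05∕family 3, programme FAMTHREE FILE
# F3-E2a; p33 g103 `g103/F3E-SCOPE.md` «Findings» §3 «THE ONE REAL OBSTACLE»; lead g34 RULINGS FAMTHREE ∕ FAMTHREE-2; division p38 g47 ∕ p33 g103 2026-08-29)

statement-level skeleton of published theorems with citation tags; proofs where landed; nothing here is a claim about the Yang–Mills mass gap

THE PRINTED LOCUS (verbatim, held `paper:balaban1985-cmp99-background-propagators`, journal page = PDF page + 388).  p. 412 l. 22–36: «We have proved in [2] that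
if we have a difference of propagators defined on two domains, then in an estimate of this difference we have, besides the usual factors …, an exponential
factor with a distance between localizations and a closest point where a change was made», «we have to notice only that the operators may differ outside
□̃₀, and the distance from □ to □̃₀ᶜ is at least M (on L^{−j}-scale)»; p. 415 l. 29–31: «Next we replace the operators G′_{□₀} and C_{□₀} by G′_□, C_□, terms
with the differences G′_{□₀} − G′_□ and C_{□₀} − C_□ are small by the same reason as before.»; p. 408: «□̃ⁿ … with the same center as □», «□̃³ ⊂ Ω_j(□)»;
p. 411 l. 36–41 («restrict a kernel of the term to points separated at least by a distance MLʲη (if □ ∈ 𝒟_j)»).  [4] = `Balaban1984PropagatorsII`: (2.46) p. 231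
(the distance `d(y, y′)` of the random walk, an infimum over admissible contours of blocks), (2.1)–(2.4) p. 224 (the blocks `𝔅`: a block of level `n` has side
`Lⁿ`; levels near a cube of `𝒟_j` are `≤ j + 1`), (2.83) p. 237 («where we have used the fact that y ∉ □̃′»).

WHY THIS FILE.  Every in-tree reading of print's «separated by a distance ≥ M» so far is of the form «blocks OUTSIDE □̃ versus blocks of □⁺» (p21
`B9Thm39CinvAtCover.hsep_cover`, p38 gen 26 `B6Partition118KLevelTorusBinders.gap_QT`, p33 `B9Eq3105ZetaY.DsepT_le_dist_bond`).  The suppliers of the located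
`G′`-difference (D1: p33 `g103/F3E-SCOPE.md` (3)–(4)) and of the located `C`-difference (D2: `g103/F3B3-SCOPE.md`) need the separation for a DIFFERENT pair:
rows within a located cut-off `χ_l` whose support (+ one gradient stencil) sits in `NearC r₁` with `r₁ ≈ 2.625S_j + 1` — which STICKS OUT of □̃ (`NearC 2S_j`) —
versus columns where the plateau `χ_□ ≠ 1` (`¬NearC 3S_j`, `B9Cor36CubeCutoffs.chiY_eq_one_of_nearC`) or in p21's transition annulus `¬NearC(3S_j − L^{j+1})`
(`B9ThmDCubeSideKernels.transInd`).  THIS FILE proves the separation for ANY two radii `r₁ ≤ r₂ ≤ 3S_j` directly on the torus, by the elementary contour count: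
along an admissible contour ([4] (2.46)) starting in `NearC r₁`, as long as the blocks stay within `3S_j` of the centre their levels are `≤ j + 1`
(`B9Cor36CubeCutoffs.levY_le_succ_of_nearC`, print's «□̃³ ⊂ Ω_j(□)»), so each bond advances every coordinate's torus distance to the centre by at most `L^{j+1}`
(one lattice step between touching blocks + the side of the next block); hence `n` bonds reach at most `NearC(r₁ + (n+1)L^{j+1} − 1)`, and a block meeting
`¬NearC r₂` is `> (r₂ + 1 − r₁)/L^{j+1} − 1` bonds away.  No chart, no depth, no wrap-around bookkeeping (`NearC` is already a torus notion).

WHAT THIS FILE CERTIFIES (kernel-checked; 0 `def`, 0 `def … : Prop`, 0 sorry; standard axioms only)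

* §1 `circAbs_le_one_of_torusSupNorm_le_one` (touching sites are within `1` in every coordinate), `nearC_of_blkOf_eq_of_le` (block-mates of a site within
  `r ≤ 3S_j` are within `r + L^{j+1} − 1`), `exists_nearC_succ_of_touchT` (a block touching a block inside `NearC ρ` has a site inside `NearC(ρ + 1)`).
* §2 ★ `nearC_of_walk` — THE CONTOUR COUNT: an admissible contour of `n` bonds from a block meeting `NearC r` with `r + n·L^{j+1} ≤ 3S_j` ends in a block all of
  whose sites are in `NearC(r + (n + 1)·L^{j+1} − 1)`.
* §3 ★★ `lt_distT_of_nearC_of_not_nearC` (`N < d_T(Δ(z), Δ(w))` whenever `z ∈ NearC r₁`, `w ∉ NearC r₂`, `r₂ ≤ 3S_j`, `r₁ + (N+1)L^{j+1} ≤ r₂ + 1`), its readings in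
  `geo9K`'s distance through `ιB` ★★ `le_dist_of_nearC_of_not_nearC` (`N + 1 ≤ d`), ★★★ `gap_div_le_dist_of_nearC_of_not_nearC`
  (`(r₂ + 1 − r₁)/L^{j+1} − 1 ≤ d`) and ★★★ `collar_le_dist_of_nearC_of_not_nearC` (`M_h·(r₂ + 1 − r₁)/S_j − 1 ≤ d`, since `S_j = M_h·L^{j+1}`).
* §4 THE CONSUMERS' PAIRS: `not_nearC_of_chiY_ne_one` (columns where `χ_□ ≠ 1` lie outside `NearC 3S_j`); for the located cut-off of p33's memo
  `χ_l := bumpY i (ctrR i □) (3·S_j)` (no new `def` — the expression is used verbatim): `nearC_of_chiL_ne_zero` (`supp χ_l ⊂ NearC(21S_j/8)`),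
  `chiL_mul_chiY` (`χ_l·χ_□ = χ_l`, F3-E1's `hχl`), `chiL_eq_one_of_nearC` (`χ_l = 1` on `NearC r`, `4r ≤ 9S_j`), `chiL_eq_one_of_zetaY_gradK` ∕
  `chiL_eq_one_of_hTY_gradK` (F3-P v2's plateau hypotheses `hζχ`∕`hhχ` at `χ := χ_l`), ★★★ `collar_le_dist_chiL_chiY` (rows `z` within one lattice step of
  `supp χ_l`, i.e. `NearC(21S_j/8 + 1)`, columns `w` with `χ_□(w) ≠ 1`: `3M_h/8 − 1 ≤ d(Δ(z), Δ(w))`) and ★★★ `collar_le_dist_chiL_annulus` (columns in p21's annulus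
  `¬NearC(3S_j − L^{j+1})`: `3M_h/8 − 2 ≤ d`), `collar_le_dist_chiL_of_not_nearC_sub_one` (p33's spelling `¬NearC(3S_j − 1)` of the middle rows: `3M_h/8 − 2 ≤ d`), `collar_pos` (`0 < 3M_h/8 − 2`, `M_h ≥ 8`), `collar_le_dist_of_not_nearC_of_nearC` (the flipped pair, for the `hDR` side; `d` is symmetric).
* §5 BOND READINGS on the member's bond carrier `ιB∘blkV1` (`Δ(f) = Δ(f₋)`): `collar_le_dist_bond`, `collar_le_dist_chiL_chiY_bond`, `collar_le_dist_chiL_annulus_bond`, `collar_le_dist_chiL_of_not_nearC_sub_one_bond`.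

HONEST SCOPE ∕ NOT CLAIMED.  Pure lattice geometry of p21's torus block graph `bondT` ([4] (2.46)) and p33's windows `NearC`; the constants `3/8`, `21/8` come from
the tree's bump profile (`bumpY`: plateau `¾ρ`, support `⅞ρ`) and are ours, not print's «≥ M»∕«≥ ⅔M» (print's cut-offs have sharper collars; any positive multiple
of `M_h` serves the consumers, whose smallness is `e^{−a·δ·d}`).  Nothing analytic: no estimate of [B9] ∕ [2] is typed here (lead g34 00:23Z: D1∕D2 stay displayed,
supplier NONE); this is the geometric input p33's memo names as the one missing piece before F3-E2∕F3-E3∕F3-B3.  Count-neutral; NOT a node discharge; no summit ∕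
sub-problem statement is proved; nothing continuum ∕ OS ∕ mass-gap ∕ Clay; YM mass gap NOT proved (Track A conditional rung).  No `sorry`, no `axiom`, no
`… : Prop` fact, no `instance`, no `notation`, no `def`.  NEW file; nothing landed is modified.  Cell `lit-balaban`, seat `lit-balaban-p38` gen 47, 2026-08-29;
`--supports stmt-QuantumFields-19200` as helper.  Net new unproved facts: 0.

RELATED IN THE TREE, NOT DUPLICATED (searched 2026-08-29: `rg 'CollarSeparation|of_not_nearC' Literature/` = ∅): p38 gen 25∕26 `B6TorusDepthDistance.gap_transfer` ∕
`B6Partition118KLevelTorusBinders.gap_QT` (the □̃ᶜ-vs-□⁺ gap through a chart — a different pair; not usable for the collar without new depth bookkeeping), p21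
`B9Thm39CinvAtCover.hsep_cover`, p33 `B9Eq3105ZetaY.DsepT_le_dist_bond`, p33 `B9Cor36CubeCutoffs` (`NearC`, `SC`, `levY_le_succ_of_nearC`, `nearC_of_blkOf_eq`,
`chiY_eq_one_of_nearC`), `B9Cor36CubeTwinsGeometry.bS`, p21 `B6Geom246MultiLevelTorus` (`bondT`, `TouchT`, `connectedT`), `B9GeoLemma21KLevelV1.geo9K_dist_eq`,
`B9Eq3105FamThreeCore` §2 (pattern for §4) — all USED BY NAME.
-/

noncomputable section

namespace Literature.MathematicalPhysics.QuantumFieldTheory.Balaban1983to89.B9Cor36CollarSeparation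

open B4TorusKernel.MultiPeriod (circAbs circAbs_le_abs circAbs_nonneg torusSupNorm)
open B4Sect5Torus (circAbs_add_le)
open B9CubeSequence408 (circAbs_sub_comm)
open B6MultiLevelTorusOperator (one_le_of_mem)
open B6KLevelCensusIndexV1 (KIdx)
open B6Cover236MultiLevelBlocks (cubes)
open B6GlobalChartV1 (blkV1)
open B6Geom246MultiLevelBox (blkOf)
open B6Geom246MultiLevelTorus (TouchT bondT bondT_adj connectedT)
open B6Ineq2142KLevelV1 (β)
open B9GeoNormsKLevelV1 (geo9K)
open B9GeoLemma21KLevelV1 (one_le_Mh one_le_P geo9K_dist_eq geo9K_dist_nonneg')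
open B9Thm37CubeCoverCommutators (hTY)
open B9Cor36CutoffField337 (bumpY bumpY_eq_one lt_of_bumpY_ne_zero)
open B9Cor36CubeCutoffs (SC NearC ctrR chiY one_le_SC nearC_of_hT_ne_zero nearC_shiftY nearC_of_blkOf_eq levY_eq_of_blkOf_eq levY_le_succ_of_nearC
  chiY_eq_one_of_nearC circR_coord_eq)
open B9Cor36CubeTwinsGeometry (bS)
open B9ThmDCubePlateau (nearC_of_mem_QbigT)
open B9Eq3104CutoffCommutators (hBdY)
open B9Eq3104CutoffCommutatorSizes (gradK_ne_zero_imp chart_tgt_eq_shiftY)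
open B9Eq3105ZetaY (zetaY mem_of_zetaY_ne_zero)
open B9CubeSequence408 (ctrC)
open Node00 (SiteY BlkY IBondY FBondY toKT levY gradK)
open Node00.OpsYNablaBridge (chartY)

variable {d ℓ : ℕ} {hd : 1 ≤ d + 1} {hL : Odd (ℓ + 1) ∧ 1 < ℓ + 1} {b₀ b₁ : ℝ}
variable (i : KIdx d ℓ hd hL b₀ b₁) (c : ↥(cubes (toKT i).D.toDomains))

/-! ## §1  One bond of an admissible contour: touching sites, block-mates, the next block -/

section OneBond

/-- touching sites of the torus (`|x − x′|_T ≤ 1`) are within `1` in every coordinate's torus distance. [cite: Balaban1984PropagatorsII, (2.46) p.231 («admissible contours»), (2.2) p.224, bookkeeping] -/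
theorem circAbs_le_one_of_torusSupNorm_le_one {x x' : SiteY i} (h : torusSupNorm (toKT i).NB (x.1 - x'.1) ≤ 1) (μ : Fin (d + 1)) :
    circAbs ((toKT i).NB μ) (x'.1 μ - x.1 μ) ≤ 1 := by
  have hN : 1 ≤ (toKT i).NB μ := one_le_of_mem x.2 μ
  have h1 : ((circAbs ((toKT i).NB μ) ((x.1 - x'.1) μ) : ℤ) : ℝ) ≤ torusSupNorm (toKT i).NB (x.1 - x'.1) :=
    Finset.le_sup' (fun ν => ((circAbs ((toKT i).NB ν) ((x.1 - x'.1) ν) : ℤ) : ℝ)) (Finset.mem_univ μ)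
  have h2 : circAbs ((toKT i).NB μ) ((x.1 - x'.1) μ) ≤ 1 := by exact_mod_cast h1.trans h
  rw [Pi.sub_apply, circAbs_sub_comm hN] at h2
  exact h2

/-- **BLOCK-MATES OF A SITE WITHIN `r ≤ 3S_j` ARE WITHIN `r + L^{j+1} − 1`**: near □ the member's level is `≤ j + 1` («□̃³ ⊂ Ω_j(□)»), so the block has side
`≤ L^{j+1}`. [cite: Balaban1985BackgroundPropagators, p.408; Balaban1984PropagatorsII, (2.1)–(2.4) p.224] -/
theorem nearC_of_blkOf_eq_of_le {r : ℤ} (hr : r ≤ 3 * SC i c) {z w : SiteY i} (hz : NearC i c r z.1)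
    (hw : blkOf i.D.toDomains w = blkOf i.D.toDomains z) : NearC i c (r + ((bS i c : ℕ) : ℤ) - 1) w.1 := by
  have h1 := nearC_of_blkOf_eq i c hw.symm hz
  have hl : levY i w ≤ c.1.1 + 1 := by
    rw [levY_eq_of_blkOf_eq i hw]; exact levY_le_succ_of_nearC i c hr hz
  have hp : (((ℓ + 1) ^ levY i w : ℕ) : ℤ) ≤ ((bS i c : ℕ) : ℤ) := by
    unfold bS; exact_mod_cast Nat.pow_le_pow_right (by omega) hl
  exact h1.mono i c (by linarith)

/-- **THE NEXT BLOCK OF A CONTOUR**: if `t` touches `s` on the torus and every site of `s` is within `ρ`, some site of `t` is within `ρ + 1`.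
[cite: Balaban1984PropagatorsII, (2.46) p.231, (2.2) p.224, bookkeeping] -/
theorem exists_nearC_succ_of_touchT {s t : BlkY i} (h : TouchT i.D s t) {ρ : ℤ} (hs : ∀ w : SiteY i, blkOf i.D.toDomains w = s → NearC i c ρ w.1) :
    ∃ x' : SiteY i, blkOf i.D.toDomains x' = t ∧ NearC i c (ρ + 1) x'.1 := by
  obtain ⟨x, x', hx, hx', hd⟩ := h
  refine ⟨x', hx', fun μ => ?_⟩
  have hN : 1 ≤ (toKT i).NB μ := one_le_of_mem x.2 μ
  have h1 := circAbs_le_one_of_torusSupNorm_le_one i hd μ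
  have t := circAbs_add_le hN (x.1 μ - ctrC c μ) (x'.1 μ - x.1 μ)
  rw [show x.1 μ - ctrC c μ + (x'.1 μ - x.1 μ) = x'.1 μ - ctrC c μ by ring] at t
  exact t.trans (add_le_add (hs x hx μ) h1)

end OneBond

/-! ## §2  The contour count -/

section Walk

/-- ★ **THE CONTOUR COUNT**: an admissible contour ([4] (2.46)) of `n` bonds starting in a block with a site in `NearC r`, `r + n·L^{j+1} ≤ 3S_j`, ends in a block
ALL of whose sites are in `NearC(r + (n + 1)·L^{j+1} − 1)` (induction on the contour: §1 per bond; the levels stay `≤ j + 1` because the contour stays within `3S_j`).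
[cite: Balaban1984PropagatorsII, (2.46) p.231, (2.1)–(2.4) p.224; Balaban1985BackgroundPropagators, p.408 («□̃³ ⊂ Ω_j(□)»), p.411 l.36–41] -/
theorem nearC_of_walk :
    ∀ {s t : BlkY i} (p : (bondT i.D).Walk s t) {r : ℤ}, (∃ z : SiteY i, blkOf i.D.toDomains z = s ∧ NearC i c r z.1) →
      r + (p.length : ℤ) * ((bS i c : ℕ) : ℤ) ≤ 3 * SC i c →
      ∀ w : SiteY i, blkOf i.D.toDomains w = t → NearC i c (r + ((p.length : ℤ) + 1) * ((bS i c : ℕ) : ℤ) - 1) w.1 := by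
  intro s t p
  induction p with
  | nil =>
    intro r hz hfit w hw
    obtain ⟨z, hzs, hz⟩ := hz
    rw [SimpleGraph.Walk.length_nil, Nat.cast_zero, zero_mul, add_zero] at hfit
    have h := nearC_of_blkOf_eq_of_le i c hfit hz (hw.trans hzs.symm)
    rw [SimpleGraph.Walk.length_nil, Nat.cast_zero, zero_add, one_mul]
    exact h
  | @cons a b' e hab p ih =>
    intro r hz hfit w hw
    obtain ⟨z, hzs, hz⟩ := hz
    have hbS : (0 : ℤ) ≤ ((bS i c : ℕ) : ℤ) := by positivity
    have hlen : ((SimpleGraph.Walk.cons hab p).length : ℤ) = (p.length : ℤ) + 1 := by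
      rw [SimpleGraph.Walk.length_cons]; push_cast; ring
    rw [hlen] at hfit ⊢
    have hr : r ≤ 3 * SC i c := by nlinarith
    -- every site of the first block is within `r + L^{j+1} − 1`
    have hall : ∀ w' : SiteY i, blkOf i.D.toDomains w' = a → NearC i c (r + ((bS i c : ℕ) : ℤ) - 1) w'.1 := fun w' hw' =>
      nearC_of_blkOf_eq_of_le i c hr hz (hw'.trans hzs.symm)
    -- the next block has a site within `r + L^{j+1}`
    obtain ⟨-, htouch⟩ := bondT_adj.1 hab
    obtain ⟨x', hx', hnear⟩ := exists_nearC_succ_of_touchT i c htouch hall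
    have e1 : r + ((bS i c : ℕ) : ℤ) - 1 + 1 = r + ((bS i c : ℕ) : ℤ) := by ring
    rw [e1] at hnear
    have key := ih (r := r + ((bS i c : ℕ) : ℤ)) ⟨x', hx', hnear⟩ (by linarith) w hw
    have e2 : r + ((bS i c : ℕ) : ℤ) + ((p.length : ℤ) + 1) * ((bS i c : ℕ) : ℤ) - 1 = r + ((p.length : ℤ) + 1 + 1) * ((bS i c : ℕ) : ℤ) - 1 := by ring
    rw [e2] at key
    exact key

end Walk

/-! ## §3  The separation -/

section Separation

/-- ★★ **THE COLLAR SEPARATION, CONTOUR FORM**: if `z ∈ NearC r₁`, `w ∉ NearC r₂`, `r₂ ≤ 3S_j` and `r₁ + (N + 1)·L^{j+1} ≤ r₂ + 1`, then every admissible contour from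
`Δ(z)` to `Δ(w)` has more than `N` bonds: `N < d_T(Δ(z), Δ(w))`. [cite: Balaban1985BackgroundPropagators, p.412 l.22–36, p.411 l.36–41, p.408; Balaban1984PropagatorsII, (2.46) p.231, (2.1)–(2.4) p.224] -/
theorem lt_distT_of_nearC_of_not_nearC {r₁ r₂ : ℤ} (hr₂ : r₂ ≤ 3 * SC i c) {z w : SiteY i} (hz : NearC i c r₁ z.1) (hw : ¬ NearC i c r₂ w.1)
    (N : ℕ) (hN : r₁ + ((N : ℤ) + 1) * ((bS i c : ℕ) : ℤ) ≤ r₂ + 1) :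
    N < (bondT i.D).dist (blkOf i.D.toDomains z) (blkOf i.D.toDomains w) := by
  have hP : ∀ μ, 1 ≤ i.P' μ := one_le_P i
  obtain ⟨p, hp⟩ := (connectedT (D := i.D) (one_le_Mh i) hP).exists_walk_length_eq_dist (blkOf i.D.toDomains z) (blkOf i.D.toDomains w)
  by_contra hle
  push Not at hle
  rw [← hp] at hle
  have hbS : (1 : ℤ) ≤ ((bS i c : ℕ) : ℤ) := by
    have : 1 ≤ bS i c := Nat.one_le_pow _ _ (by omega)
    exact_mod_cast this
  have hle' : (p.length : ℤ) ≤ (N : ℤ) := by exact_mod_cast hle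
  have hfit : r₁ + (p.length : ℤ) * ((bS i c : ℕ) : ℤ) ≤ 3 * SC i c := by nlinarith
  have key := nearC_of_walk i c p ⟨z, rfl, hz⟩ hfit w rfl
  exact hw (key.mono i c (by nlinarith))

variable (ιB : BlkY i → IBondY i) (hι : ∀ s, β i.hN i.D i.hk (ιB s) = s)
include hι

/-- ★★ **THE COLLAR SEPARATION IN `geo9K`'s DISTANCE**: `N + 1 ≤ d(ιB Δ(z), ιB Δ(w))` under the same hypotheses (`geo9K_dist_eq`: `d` IS `d_T` of the carrier blocks).
[cite: Balaban1985BackgroundPropagators, p.412 l.22–36, p.411 l.36–41; Balaban1984PropagatorsII, (2.46) p.231] -/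
theorem le_dist_of_nearC_of_not_nearC {r₁ r₂ : ℤ} (hr₂ : r₂ ≤ 3 * SC i c) {z w : SiteY i} (hz : NearC i c r₁ z.1) (hw : ¬ NearC i c r₂ w.1)
    (N : ℕ) (hN : r₁ + ((N : ℤ) + 1) * ((bS i c : ℕ) : ℤ) ≤ r₂ + 1) :
    (N : ℝ) + 1 ≤ (geo9K i).dist (ιB (blkOf i.D.toDomains z)) (ιB (blkOf i.D.toDomains w)) := by
  rw [geo9K_dist_eq, hι, hι]
  have h := lt_distT_of_nearC_of_not_nearC i c hr₂ hz hw N hN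
  exact_mod_cast Nat.succ_le_of_lt h

/-- ★★★ **THE COLLAR SEPARATION, GAP FORM**: `(r₂ + 1 − r₁)/L^{j+1} − 1 ≤ d(ιB Δ(z), ιB Δ(w))` for `z ∈ NearC r₁`, `w ∉ NearC r₂`, `r₂ ≤ 3S_j` (take
`N + 1 = ⌊(r₂ + 1 − r₁)/L^{j+1}⌋`). [cite: Balaban1985BackgroundPropagators, p.412 l.22–36 («the distance from □ to □̃₀ᶜ is at least M (on L^{−j}-scale)»), p.411 l.36–41; Balaban1984PropagatorsII, (2.46) p.231, (2.1) p.224] -/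
theorem gap_div_le_dist_of_nearC_of_not_nearC {r₁ r₂ : ℤ} (hr₂ : r₂ ≤ 3 * SC i c) {z w : SiteY i} (hz : NearC i c r₁ z.1) (hw : ¬ NearC i c r₂ w.1) :
    (((r₂ + 1 - r₁ : ℤ) : ℝ)) / (bS i c : ℝ) - 1 ≤ (geo9K i).dist (ιB (blkOf i.D.toDomains z)) (ιB (blkOf i.D.toDomains w)) := by
  have hbS1 : 1 ≤ bS i c := Nat.one_le_pow _ _ (by omega)
  have hbS : (0 : ℝ) < (bS i c : ℝ) := by exact_mod_cast hbS1
  have hd0 : 0 ≤ (geo9K i).dist (ιB (blkOf i.D.toDomains z)) (ιB (blkOf i.D.toDomains w)) := geo9K_dist_nonneg' i _ _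
  set G : ℤ := r₂ + 1 - r₁ with hG
  -- the number of whole block-sides in the gap
  set q : ℤ := G / ((bS i c : ℕ) : ℤ) with hq
  have hbz : (0 : ℤ) < ((bS i c : ℕ) : ℤ) := by exact_mod_cast hbS1
  have hqG : q * ((bS i c : ℕ) : ℤ) ≤ G := Int.ediv_mul_le _ hbz.ne'
  have hGq : G < (q + 1) * ((bS i c : ℕ) : ℤ) := by
    have := Int.lt_ediv_add_one_mul_self G hbz
    linarith [this]
  -- `G/bS − 1 < q`
  have hreal : ((G : ℤ) : ℝ) / (bS i c : ℝ) - 1 < (q : ℝ) := by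
    rw [sub_lt_iff_lt_add, div_lt_iff₀ hbS]
    have : ((G : ℤ) : ℝ) < ((q : ℝ) + 1) * (bS i c : ℝ) := by
      have h' : ((G : ℤ) : ℝ) < (((q + 1) * ((bS i c : ℕ) : ℤ) : ℤ) : ℝ) := by exact_mod_cast hGq
      push_cast at h'
      exact h'
    linarith
  by_cases hq1 : q < 1
  · -- the gap holds less than one block-side: the bound is `< 0 ≤ d`
    have : (q : ℝ) ≤ 0 := by exact_mod_cast (show q ≤ 0 by omega)
    linarith
  · push Not at hq1
    obtain ⟨N, hNq⟩ : ∃ N : ℕ, (N : ℤ) + 1 = q := ⟨(q - 1).toNat, by rw [Int.toNat_of_nonneg (by omega)]; ring⟩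
    have hN : r₁ + ((N : ℤ) + 1) * ((bS i c : ℕ) : ℤ) ≤ r₂ + 1 := by rw [hNq]; linarith
    have key := le_dist_of_nearC_of_not_nearC i c ιB hι hr₂ hz hw N hN
    have e : (q : ℝ) = (N : ℝ) + 1 := by rw [← hNq]; push_cast; ring
    linarith

/-- ★★★ **THE COLLAR SEPARATION IN UNITS OF `M_h`**: `M_h·(r₂ + 1 − r₁)/S_j − 1 ≤ d(ιB Δ(z), ιB Δ(w))` (`S_j = M_h·L^{j+1}`) — for a gap of `κ·S_j` lattice units the
blocks are `≥ κ·M_h − 1` apart in the distance (2.46), print's «at least M (on L^{−j}-scale)» up to the tree's normalisation (`DsepT = M_h/(2L)` for the □̃ᶜ-vs-□⁺ pair).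
[cite: Balaban1985BackgroundPropagators, p.412 l.22–36, p.411 l.36–41; Balaban1984PropagatorsII, (2.46) p.231, (2.1) p.224, (2.83) p.237] -/
theorem collar_le_dist_of_nearC_of_not_nearC {r₁ r₂ : ℤ} (hr₂ : r₂ ≤ 3 * SC i c) {z w : SiteY i} (hz : NearC i c r₁ z.1) (hw : ¬ NearC i c r₂ w.1) :
    (i.Mh : ℝ) * (((r₂ + 1 - r₁ : ℤ) : ℝ)) / (SC i c : ℝ) - 1 ≤ (geo9K i).dist (ιB (blkOf i.D.toDomains z)) (ιB (blkOf i.D.toDomains w)) := by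
  have hSC : (SC i c : ℝ) = (i.Mh : ℝ) * (bS i c : ℝ) := by
    have h' : (SC i c : ℤ) = ((i.Mh * (ℓ + 1) ^ (c.1.1 + 1) : ℕ) : ℤ) := rfl
    rw [h']
    unfold bS; push_cast; ring
  have hMh : (0 : ℝ) < (i.Mh : ℝ) := by
    have := one_le_Mh i
    exact_mod_cast (show 0 < i.Mh by omega)
  have hbS : (0 : ℝ) < (bS i c : ℝ) := by exact_mod_cast Nat.one_le_pow _ _ (by omega)
  have e : (i.Mh : ℝ) * (((r₂ + 1 - r₁ : ℤ) : ℝ)) / (SC i c : ℝ) = (((r₂ + 1 - r₁ : ℤ) : ℝ)) / (bS i c : ℝ) := by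
    rw [hSC]; field_simp
  rw [e]
  exact gap_div_le_dist_of_nearC_of_not_nearC i c ιB hι hr₂ hz hw

end Separation

/-! ## §4  The consumers' pairs: the located cut-off `χ_l = bumpY i (ctrR i □) (3S_j)` versus `{χ_□ ≠ 1}` and versus p21's annulus -/

section Consumers

/-- columns where the plateau `χ_□ ≠ 1` are outside `NearC 3S_j`. [cite: Balaban1985BackgroundPropagators, p.408; Balaban1984PropagatorsI, (1.118) p.36] -/
theorem not_nearC_of_chiY_ne_one {w : SiteY i} (hw : chiY i c w ≠ 1) : ¬ NearC i c (3 * SC i c) w.1 := fun h =>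
  hw (chiY_eq_one_of_nearC i c le_rfl h)

/-- **`supp χ_l ⊂ NearC(21S_j/8)`** (`⅞·3S_j`). [cite: Balaban1984PropagatorsI, (1.118) p.36 («h ∈ C₀^∞»), bookkeeping] -/
theorem nearC_of_chiL_ne_zero {z : SiteY i} (h : bumpY i (ctrR i c) (3 * (SC i c : ℝ)) z ≠ 0) : NearC i c (21 * SC i c / 8) z.1 := by
  intro μ
  have hS : (1 : ℝ) ≤ (SC i c : ℝ) := by exact_mod_cast one_le_SC i c
  have h1 := lt_of_bumpY_ne_zero i (by positivity) h μ
  rw [circR_coord_eq] at h1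
  have h2 : 8 * circAbs ((toKT i).NB μ) (z.1 μ - ctrC c μ) < 21 * SC i c := by
    have : (8 : ℝ) * ((circAbs ((toKT i).NB μ) (z.1 μ - ctrC c μ) : ℤ) : ℝ) < 21 * (SC i c : ℝ) := by linarith
    exact_mod_cast this
  rw [Int.le_ediv_iff_mul_le (by norm_num : (0 : ℤ) < 8)]
  linarith

/-- **`χ_l·χ_□ = χ_l`** (F3-E1's `hχl`: on `supp χ_l ⊂ NearC(21S_j/8) ⊂ NearC 3S_j` the plateau is `1`). [cite: Balaban1985BackgroundPropagators, p.408; Balaban1984PropagatorsI, (1.118) p.36] -/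
theorem chiL_mul_chiY (z : SiteY i) : bumpY i (ctrR i c) (3 * (SC i c : ℝ)) z * chiY i c z = bumpY i (ctrR i c) (3 * (SC i c : ℝ)) z := by
  by_cases h : bumpY i (ctrR i c) (3 * (SC i c : ℝ)) z = 0
  · rw [h, zero_mul]
  · have hS := one_le_SC i c
    rw [chiY_eq_one_of_nearC i c (r := 21 * SC i c / 8) (by omega) (nearC_of_chiL_ne_zero i c h), mul_one]

/-- **`χ_l = 1` on `NearC r` whenever `4r ≤ 9S_j`** (plateau radius `¾·3S_j`). [cite: Balaban1984PropagatorsI, (1.118) p.36 («h(t) = 1 for …»); Balaban1985BackgroundPropagators, p.408] -/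
theorem chiL_eq_one_of_nearC {r : ℤ} (hr : 4 * r ≤ 9 * SC i c) {z : SiteY i} (hz : NearC i c r z.1) : bumpY i (ctrR i c) (3 * (SC i c : ℝ)) z = 1 := by
  have hS : (1 : ℝ) ≤ (SC i c : ℝ) := by exact_mod_cast one_le_SC i c
  refine bumpY_eq_one i (by positivity) fun ν => ?_
  rw [circR_coord_eq]
  have h1 : ((circAbs ((toKT i).NB ν) (z.1 ν - ctrC c ν) : ℤ) : ℝ) ≤ (r : ℝ) := by exact_mod_cast hz ν
  have h2 : 4 * (r : ℝ) ≤ 9 * (SC i c : ℝ) := by exact_mod_cast hr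
  linarith

/-- ★ F3-P v2's `hζχ` at `χ := χ_l`: `ζ_□̃♭(b) ≠ 0` and `z` on the gradient stencil of `b` ⟹ `χ_l(z) = 1` (`□̃ ⊂ NearC 2S_j`, stencil `+1`, `4(2S_j + 1) ≤ 9S_j`).
[cite: Balaban1985BackgroundPropagators, (3.105) p.414 («ζ_□̃ ∈ C₀^∞(□̃)»), p.408, (3.8) p.392; Balaban1984PropagatorsII, (2.2) p.224] -/
theorem chiL_eq_one_of_zetaY_gradK {bnd : FBondY i} {z : SiteY i} (hf : hBdY i (zetaY i c) bnd ≠ 0) (hz : gradK i bnd z ≠ 0) :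
    bumpY i (ctrR i c) (3 * (SC i c : ℝ)) z = 1 := by
  have hS := one_le_SC i c
  have h9 := B9Cor36CubeCutoffs.nine_le_SC i c
  have hsrc : NearC i c (2 * SC i c) (chartY i bnd.src).1 := nearC_of_mem_QbigT i c (mem_of_zetaY_ne_zero i c hf) rfl
  rcases gradK_ne_zero_imp i hz with h1 | h1
  · rw [h1]; exact chiL_eq_one_of_nearC i c (by linarith) hsrc
  · rw [h1, chart_tgt_eq_shiftY]
    exact chiL_eq_one_of_nearC i c (by linarith) (nearC_shiftY i c hsrc bnd.dir)

/-- ★ F3-P v2's `hhχ` at `χ := χ_l`: `h_□♭(b) ≠ 0` and `z` on the gradient stencil of `b` ⟹ `χ_l(z) = 1` (`supp h_□ ⊂ NearC S_j`).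
[cite: Balaban1985BackgroundPropagators, (3.87) p.409, p.408, (3.8) p.392; Balaban1984PropagatorsII, (2.36) p.229, (2.2) p.224] -/
theorem chiL_eq_one_of_hTY_gradK {bnd : FBondY i} {z : SiteY i} (hf : hBdY i (hTY i c) bnd ≠ 0) (hz : gradK i bnd z ≠ 0) :
    bumpY i (ctrR i c) (3 * (SC i c : ℝ)) z = 1 := by
  have hS := one_le_SC i c
  have hsrc : NearC i c (SC i c) (chartY i bnd.src).1 := nearC_of_hT_ne_zero i c hf
  rcases gradK_ne_zero_imp i hz with h1 | h1
  · rw [h1]; exact chiL_eq_one_of_nearC i c (by linarith) hsrc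
  · rw [h1, chart_tgt_eq_shiftY]
    exact chiL_eq_one_of_nearC i c (by linarith) (nearC_shiftY i c hsrc bnd.dir)

variable (ιB : BlkY i → IBondY i) (hι : ∀ s, β i.hN i.D i.hk (ιB s) = s)
include hι

/-- ★★★ **ROWS WITHIN ONE STEP OF `supp χ_l`, COLUMNS WHERE `χ_□ ≠ 1`: `3M_h/8 − 1 ≤ d`** — the gap piece of the located `G′`-difference (p33 `g103/F3E-SCOPE.md` (3)):
rows `z ∈ NearC(21S_j/8 + 1)` (a site of `supp χ_l` or a lattice neighbour of one), columns `w` with `χ_□(w) ≠ 1`.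
[cite: Balaban1985BackgroundPropagators, p.412 l.22–36, p.415 l.29–31, p.408; Balaban1984PropagatorsII, (2.46) p.231, (2.83) p.237] -/
theorem collar_le_dist_chiL_chiY {z w : SiteY i} (hz : NearC i c (21 * SC i c / 8 + 1) z.1) (hw : chiY i c w ≠ 1) :
    3 / 8 * (i.Mh : ℝ) - 1 ≤ (geo9K i).dist (ιB (blkOf i.D.toDomains z)) (ιB (blkOf i.D.toDomains w)) := by
  have key := collar_le_dist_of_nearC_of_not_nearC i c ιB hι le_rfl hz (not_nearC_of_chiY_ne_one i c hw)
  have hS1 := one_le_SC i c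
  have hS : (0 : ℝ) < (SC i c : ℝ) := by exact_mod_cast (show (0 : ℤ) < SC i c by omega)
  have hMh : (0 : ℝ) ≤ (i.Mh : ℝ) := by positivity
  -- `3S − ⌊21S/8⌋ ≥ 3S/8`
  have hgap : 3 * (SC i c : ℝ) ≤ 8 * (((3 * SC i c + 1 - (21 * SC i c / 8 + 1) : ℤ) : ℝ)) := by
    have h8 : 8 * (21 * SC i c / 8) ≤ 21 * SC i c := Int.mul_ediv_self_le (by norm_num)
    have : 3 * SC i c ≤ 8 * (3 * SC i c + 1 - (21 * SC i c / 8 + 1)) := by omega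
    have h' : ((3 * SC i c : ℤ) : ℝ) ≤ ((8 * (3 * SC i c + 1 - (21 * SC i c / 8 + 1)) : ℤ) : ℝ) := Int.cast_le.mpr this
    have e1 : ((3 * SC i c : ℤ) : ℝ) = 3 * (SC i c : ℝ) := by push_cast; ring
    have e2 : ((8 * (3 * SC i c + 1 - (21 * SC i c / 8 + 1)) : ℤ) : ℝ) = 8 * (((3 * SC i c + 1 - (21 * SC i c / 8 + 1) : ℤ) : ℝ)) := by
      push_cast; ring
    rw [e1, e2] at h'
    exact h'
  have hmono : 3 / 8 * (i.Mh : ℝ) ≤ (i.Mh : ℝ) * (((3 * SC i c + 1 - (21 * SC i c / 8 + 1) : ℤ) : ℝ)) / (SC i c : ℝ) := by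
    rw [le_div_iff₀ hS]
    nlinarith
  linarith

/-- ★★★ **ROWS WITHIN ONE STEP OF `supp χ_l`, COLUMNS IN p21's TRANSITION ANNULUS `¬NearC(3S_j − L^{j+1})`: `3M_h/8 − 2 ≤ d`** — the middle variable of the commutator
piece (`B9ThmDCubeSideKernels.transInd`; p33 `g103/F3E-SCOPE.md` (4), `g103/F3B3-SCOPE.md`).
[cite: Balaban1985BackgroundPropagators, p.412 l.22–36, p.415 l.29–37, (3.89) p.409, p.408; Balaban1984PropagatorsII, (2.46) p.231, (2.83) p.237] -/
theorem collar_le_dist_chiL_annulus {z w : SiteY i} (hz : NearC i c (21 * SC i c / 8 + 1) z.1) (hw : ¬ NearC i c (3 * SC i c - ((bS i c : ℕ) : ℤ)) w.1) :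
    3 / 8 * (i.Mh : ℝ) - 2 ≤ (geo9K i).dist (ιB (blkOf i.D.toDomains z)) (ιB (blkOf i.D.toDomains w)) := by
  have hbS0 : (0 : ℤ) ≤ ((bS i c : ℕ) : ℤ) := by positivity
  have key := collar_le_dist_of_nearC_of_not_nearC i c ιB hι (r₂ := 3 * SC i c - ((bS i c : ℕ) : ℤ)) (by linarith) hz hw
  have hS1 := one_le_SC i c
  have hS : (0 : ℝ) < (SC i c : ℝ) := by exact_mod_cast (show (0 : ℤ) < SC i c by omega)
  have hMh : (0 : ℝ) ≤ (i.Mh : ℝ) := by positivity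
  have hSC : (SC i c : ℝ) = (i.Mh : ℝ) * (bS i c : ℝ) := by
    have h' : (SC i c : ℤ) = ((i.Mh * (ℓ + 1) ^ (c.1.1 + 1) : ℕ) : ℤ) := rfl
    rw [h']
    unfold bS; push_cast; ring
  -- `3S − bS − ⌊21S/8⌋ ≥ 3S/8 − bS`, and `M_h·bS/S = 1`
  have hgap : 3 * (SC i c : ℝ) - 8 * (bS i c : ℝ) ≤ 8 * (((3 * SC i c - ((bS i c : ℕ) : ℤ) + 1 - (21 * SC i c / 8 + 1) : ℤ) : ℝ)) := by
    have h8 : 8 * (21 * SC i c / 8) ≤ 21 * SC i c := Int.mul_ediv_self_le (by norm_num)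
    have : 3 * SC i c - 8 * ((bS i c : ℕ) : ℤ) ≤ 8 * (3 * SC i c - ((bS i c : ℕ) : ℤ) + 1 - (21 * SC i c / 8 + 1)) := by omega
    have h' : ((3 * SC i c - 8 * ((bS i c : ℕ) : ℤ) : ℤ) : ℝ) ≤ ((8 * (3 * SC i c - ((bS i c : ℕ) : ℤ) + 1 - (21 * SC i c / 8 + 1)) : ℤ) : ℝ) :=
      Int.cast_le.mpr this
    have e1 : ((3 * SC i c - 8 * ((bS i c : ℕ) : ℤ) : ℤ) : ℝ) = 3 * (SC i c : ℝ) - 8 * (bS i c : ℝ) := by push_cast; ring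
    have e2 : ((8 * (3 * SC i c - ((bS i c : ℕ) : ℤ) + 1 - (21 * SC i c / 8 + 1)) : ℤ) : ℝ) =
        8 * (((3 * SC i c - ((bS i c : ℕ) : ℤ) + 1 - (21 * SC i c / 8 + 1) : ℤ) : ℝ)) := by
      push_cast; ring
    rw [e1, e2] at h'
    exact h'
  have hmono : 3 / 8 * (i.Mh : ℝ) - 1 ≤ (i.Mh : ℝ) * (((3 * SC i c - ((bS i c : ℕ) : ℤ) + 1 - (21 * SC i c / 8 + 1) : ℤ) : ℝ)) / (SC i c : ℝ) := by
    rw [le_div_iff₀ hS]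
    have e : (3 / 8 * (i.Mh : ℝ) - 1) * (SC i c : ℝ) = (i.Mh : ℝ) * ((3 * (SC i c : ℝ) - 8 * (bS i c : ℝ)) / 8) := by
      rw [hSC]; ring
    rw [e]
    have : (3 * (SC i c : ℝ) - 8 * (bS i c : ℝ)) / 8 ≤ (((3 * SC i c - ((bS i c : ℕ) : ℤ) + 1 - (21 * SC i c / 8 + 1) : ℤ) : ℝ)) := by linarith
    exact mul_le_mul_of_nonneg_left this hMh
  linarith

/-- p33's spelling of the middle variable's rows («sites whose stencil sees a non-constant `χ_□`», `¬NearC(3S_j − 1) ⊂ ¬NearC(3S_j − L^{j+1})`): `3M_h/8 − 2 ≤ d`.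
[cite: Balaban1985BackgroundPropagators, p.412 l.22–36, (3.89) p.409; Balaban1984PropagatorsII, (2.46) p.231] -/
theorem collar_le_dist_chiL_of_not_nearC_sub_one {z w : SiteY i} (hz : NearC i c (21 * SC i c / 8 + 1) z.1) (hw : ¬ NearC i c (3 * SC i c - 1) w.1) :
    3 / 8 * (i.Mh : ℝ) - 2 ≤ (geo9K i).dist (ιB (blkOf i.D.toDomains z)) (ιB (blkOf i.D.toDomains w)) := by
  have hbS1 : (1 : ℤ) ≤ ((bS i c : ℕ) : ℤ) := by exact_mod_cast Nat.one_le_pow _ _ (by omega)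
  exact collar_le_dist_chiL_annulus i c ιB hι hz fun h => hw (h.mono i c (by linarith))

omit hι in
/-- the two collar constants are POSITIVE (`M_h ≥ 8`): `0 < 3M_h/8 − 2 ≤ 3M_h/8 − 1`. [cite: Balaban1984PropagatorsII, (2.1) p.224 («M sufficiently large»), bookkeeping] -/
theorem collar_pos : (0 : ℝ) < 3 / 8 * (i.Mh : ℝ) - 2 ∧ (0 : ℝ) < 3 / 8 * (i.Mh : ℝ) - 1 := by
  have h8 : (8 : ℝ) ≤ (i.Mh : ℝ) := by exact_mod_cast i.hM8
  constructor <;> linarith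

/-- the flipped pair (rows far, columns near — the `hDR` side): `M_h·(r₂ + 1 − r₁)/S_j − 1 ≤ d(ιB Δ(w), ιB Δ(z))` (`d` is symmetric).
[cite: Balaban1985BackgroundPropagators, p.412 l.22–36; Balaban1984PropagatorsII, (2.46) p.231 (a graph distance is symmetric)] -/
theorem collar_le_dist_of_not_nearC_of_nearC {r₁ r₂ : ℤ} (hr₂ : r₂ ≤ 3 * SC i c) {z w : SiteY i} (hz : NearC i c r₁ z.1) (hw : ¬ NearC i c r₂ w.1) :
    (i.Mh : ℝ) * (((r₂ + 1 - r₁ : ℤ) : ℝ)) / (SC i c : ℝ) - 1 ≤ (geo9K i).dist (ιB (blkOf i.D.toDomains w)) (ιB (blkOf i.D.toDomains z)) := by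
  rw [B9GeoLemma21KLevelV1.geo9K_dist_comm]
  exact collar_le_dist_of_nearC_of_not_nearC i c ιB hι hr₂ hz hw

end Consumers

/-! ## §5  Bond readings: the member's bond carrier `fun p => ιB (blkV1 i.hN i.D p.1)` (`Δ(f) = Δ(f₋)`, the block of the source chart) -/

section Bond

variable (ιB : BlkY i → IBondY i) (hι : ∀ s, β i.hN i.D i.hk (ιB s) = s)
include hι

/-- ★★ the collar separation ON THE BOND CARRIER: `f₋ ∈ NearC r₁`, `g₋ ∉ NearC r₂`, `r₂ ≤ 3S_j` ⟹ `M_h·(r₂ + 1 − r₁)/S_j − 1 ≤ d(ιB Δ(f), ιB Δ(g))`.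
[cite: Balaban1985BackgroundPropagators, p.412 l.22–36, (3.87) p.409 (bond letters read at the source); Balaban1984PropagatorsII, (2.46) p.231] -/
theorem collar_le_dist_bond {r₁ r₂ : ℤ} (hr₂ : r₂ ≤ 3 * SC i c) {f g : FBondY i} (hf : NearC i c r₁ (chartY i f.src).1)
    (hg : ¬ NearC i c r₂ (chartY i g.src).1) :
    (i.Mh : ℝ) * (((r₂ + 1 - r₁ : ℤ) : ℝ)) / (SC i c : ℝ) - 1 ≤ (geo9K i).dist (ιB (blkV1 i.hN i.D f)) (ιB (blkV1 i.hN i.D g)) :=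
  collar_le_dist_of_nearC_of_not_nearC i c ιB hι hr₂ hf hg

/-- ★★★ bond rows within one step of `supp χ_l`, bond columns where `χ_□(g₋) ≠ 1`: `3M_h/8 − 1 ≤ d(ιB Δ(f), ιB Δ(g))`.
[cite: Balaban1985BackgroundPropagators, p.412 l.22–36, p.415 l.29–31, (3.87) p.409; Balaban1984PropagatorsII, (2.46) p.231, (2.83) p.237] -/
theorem collar_le_dist_chiL_chiY_bond {f g : FBondY i} (hf : NearC i c (21 * SC i c / 8 + 1) (chartY i f.src).1) (hg : chiY i c (chartY i g.src) ≠ 1) :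
    3 / 8 * (i.Mh : ℝ) - 1 ≤ (geo9K i).dist (ιB (blkV1 i.hN i.D f)) (ιB (blkV1 i.hN i.D g)) :=
  collar_le_dist_chiL_chiY i c ιB hι hf hg

/-- ★★★ bond rows within one step of `supp χ_l`, bond columns in p21's annulus: `3M_h/8 − 2 ≤ d(ιB Δ(f), ιB Δ(g))`.
[cite: Balaban1985BackgroundPropagators, p.412 l.22–36, p.415 l.29–37, (3.89) p.409; Balaban1984PropagatorsII, (2.46) p.231, (2.83) p.237] -/
theorem collar_le_dist_chiL_annulus_bond {f g : FBondY i} (hf : NearC i c (21 * SC i c / 8 + 1) (chartY i f.src).1)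
    (hg : ¬ NearC i c (3 * SC i c - ((bS i c : ℕ) : ℤ)) (chartY i g.src).1) :
    3 / 8 * (i.Mh : ℝ) - 2 ≤ (geo9K i).dist (ιB (blkV1 i.hN i.D f)) (ιB (blkV1 i.hN i.D g)) :=
  collar_le_dist_chiL_annulus i c ιB hι hf hg

/-- p33's spelling on the bond carrier: columns `g₋ ∉ NearC(3S_j − 1)`: `3M_h/8 − 2 ≤ d(ιB Δ(f), ιB Δ(g))`.
[cite: Balaban1985BackgroundPropagators, p.412 l.22–36, (3.89) p.409; Balaban1984PropagatorsII, (2.46) p.231] -/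
theorem collar_le_dist_chiL_of_not_nearC_sub_one_bond {f g : FBondY i} (hf : NearC i c (21 * SC i c / 8 + 1) (chartY i f.src).1)
    (hg : ¬ NearC i c (3 * SC i c - 1) (chartY i g.src).1) :
    3 / 8 * (i.Mh : ℝ) - 2 ≤ (geo9K i).dist (ιB (blkV1 i.hN i.D f)) (ιB (blkV1 i.hN i.D g)) :=
  collar_le_dist_chiL_of_not_nearC_sub_one i c ιB hι hf hg

end Bond

end Literature.MathematicalPhysics.QuantumFieldTheory.Balaban1983to89.B9Cor36CollarSeparation

end
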